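import Lean

namespace HostAPI.Util

@[unused_variables_ignore_fn]
def ignoreForallBinder : Lean.Linter.IgnoreFunction := fun _ stack _ =>
  stack.matches [`null, ``Lean.Parser.Term.explicitBinder, `null, ``Lean.Parser.Term.forall] ||
  stack.matches [`null, ``Lean.Parser.Term.implicitBinder, `null, ``Lean.Parser.Term.forall] ||
  stack.matches [`null, ``Lean.Parser.Term.strictImplicitBinder, `null, ``Lean.Parser.Term.forall]

end HostAPI.Util
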